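import Summits.ABC.IUTFork.Joshi.TensorNormsNonArch
import Literature.Analysis.OperatorTheory.NonArchFiniteHahnBanach
import HarnessLib

/-!
# Joshi's §7.6, part 5 (arXiv:2401.13508 v4, Thm 7.6.2.2 (3)(4), p. 62 l. 11–14; Lemma 7.6.6.1 (7.6.6.2), p. 64 l. 3–26):
# the cross-norm property of the NON-ARCHIMEDEAN projective tensor norm — PROVED ([Schneider 2002, Prop. 17.4])

Record file of the abc-iut cell, branch E (rung LADDER-ABC:A2.E; seat abc-iut-E-t14, slot T-14). Source / bib (`Joshi2024ATS3`) /
framing as in `Joshi/TensorNorms.lean` (UNREFEREED preprint, disputed in print [Mochizuki2024JoshiReport]; typed ≠ proved ≠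
endorsed; no side taken; nothing here asserts abc or [IUTchIII] Cor. 3.12). What is PROVED here is classical non-archimedean
functional analysis, not a claim of the disputed source.

MAIN THEOREM (`maxProjNorm_tprod`). Let `𝕜` be a COMPLETE non-archimedean (ultrametric) nontrivially normed field and `V_i`
(`i ∈ ι`, finite) ultrametric normed `𝕜`-spaces. Then the non-archimedean projective tensor norm of part 4
(`TensorNorm.maxProjNorm` = `π_max` of [Bosch–Güntzer–Remmert 1984, 2.1.7] / [Schneider 2002, §17]) is a cross norm:
`π_max(⨂ₜ m) = ∏ ‖m_i‖` — [Schneider 2002, Prop. 17.4] in the finite-family generality; hence also Mathlib's `π_Σ`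
(`hasCrossNorm_norm_of_ultrametric`). Proof: for a representation `⨂ₜ m = Σ_j c_j · ⨂ₜ m_j` and `0 < t < 1`, the non-archimedean
Hahn–Banach lemma WITH LOSS on finite-dimensional subspaces (`Literature.Analysis.OperatorTheory.exists_dual_norming_on_span`,
this seat, p431813 — no spherical completeness, no Ingleton) gives linear `ψ_i` with `ψ_i(m_i) = 1` and
`t ‖m_i‖ ‖ψ_i(m_{j,i})‖ ≤ ‖m_{j,i}‖` for all `j`; applying `⊗ ψ_i` to the representation, `1 = Σ_j c_j ∏_i ψ_i(m_{j,i})`, so by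
the ultrametric inequality some term has `‖c_j‖ ∏ ‖ψ_i(m_{j,i})‖ ≥ 1`, whence `t^n ∏ ‖m_i‖ ≤ ‖c_j‖ ∏ ‖m_{j,i}‖ ≤ maxCost`;
let `t → 1`.

RELATION TO THE TREE. The p-adic / spherically-complete case was discharged FIRST by the cell's foundations seat via Ingleton's
theorem (`Joshi/TensorNormsNonArchUltrametric.lean`, abc-iut-found p431820: `maxProjNorm_tprod_padic` over `ℚ_p`,
`maxProjNorm_tprod_of_isSphericallyComplete`, `norm_tprod_padic_ultrametric`, with the refutations
`not_crossNormMaxClaim_padic` / `not_crossNormMaxSeminormedClaim_padic` of part 4's Props AS TYPED — they quantify over all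
Mathlib normed spaces, and for the non-ultrametric `ℓ¹(ℚ_p²)` `π_max` is not cross; abc-iut-E-t44 p431661
`not_bidual_hypothesis_padic` likewise bounds part 3's reductions). Print's «Banach spaces over a p-adic field» are ULTRAMETRIC by
the standing convention of its references ([Schneider 2002, Ch. I]; [Perez-Garcia–Schikhof 2010, §3.1]), so the faithful reading
of Thm 7.6.2.2 (3)/(4)/(5) carries `[∀ i, IsUltrametricDist (V i)]` and is a THEOREM. What THIS file adds: the theorem over EVERY
COMPLETE non-archimedean field (e.g. `ℂ_p`, which is not spherically complete — Ingleton's theorem is unavailable there), i.e.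
[Schneider 2002, Prop. 17.4] in its own generality, from the finite-dimensional Hahn–Banach-with-loss lemma instead of Ingleton;
the p-adic-field encoding of parts 1/4 (`[NormedAlgebra ℚ_[p] E] [FiniteDimensional ℚ_[p] E]`) as a direct corollary
(`maxProjNorm_tprod_padicField`, `norm_tprod_padicField`); and the final faithful typing of (2) with the ultrametric binder
(`ProjEqInjUltraClaim`, still a hypothesis: orthogonal bases over spherically complete fields, [van der Put–van Tiel 1967]).

No instance, notation or axiom is declared.
-/

noncomputable section

open scoped TensorProduct Topology
open PiTensorProduct Filter

universe u v w

namespace Summit.ABC.IUTFork.Joshi.TensorNorm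

/-! ## 1. The cross-norm property of `π_max` over a complete ultrametric field -/

section Cross

variable {ι : Type*} [Fintype ι] {𝕜 : Type*} [NontriviallyNormedField 𝕜] [CompleteSpace 𝕜] [IsUltrametricDist 𝕜]
  {V : ι → Type*} [∀ i, NormedAddCommGroup (V i)] [∀ i, NormedSpace 𝕜 (V i)] [∀ i, IsUltrametricDist (V i)]

omit [Fintype ι] [CompleteSpace 𝕜] [IsUltrametricDist 𝕜] [∀ i, NormedSpace 𝕜 (V i)] [∀ i, IsUltrametricDist (V i)] in
/-- Ultrametric pigeonhole for a list sum: if `0 < a ≤ ‖Σ l‖` then some member has norm `≥ a`. -/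
private theorem exists_norm_ge_of_le_norm_sum {X : Type*} [SeminormedAddCommGroup X] [IsUltrametricDist X] {a : ℝ}
    (ha : 0 < a) : ∀ l : List X, a ≤ ‖l.sum‖ → ∃ x ∈ l, a ≤ ‖x‖
  | [], h => absurd h (by simpa using ha)
  | x :: l, h => by
    rw [List.sum_cons] at h
    rcases le_max_iff.1 (h.trans (IsUltrametricDist.norm_add_le_max _ _)) with hx | hl
    · exact ⟨x, by simp, hx⟩
    · obtain ⟨y, hy, hay⟩ := exists_norm_ge_of_le_norm_sum ha l hl
      exact ⟨y, by simp [hy], hay⟩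

/-- **Per-representation bound.** For every representation `p` of the pure tensor `⨂ₜ m` and every `0 < t < 1`:
`t^{#ι} ∏ ‖m_i‖ ≤ maxCost p` (the `t`-norming functionals of the finite-dimensional spans of the components, evaluated through
`⊗ ψ_i` on the representation; ultrametric pigeonhole). [Schneider 2002, Prop. 17.4, proof] -/
theorem pow_mul_prod_norm_le_maxCost (m : Π i, V i) {p : FreeAddMonoid (𝕜 × Π i, V i)}
    (hp : p ∈ lifts (⨂ₜ[𝕜] i, m i)) {t : ℝ} (ht0 : 0 < t) (ht1 : t < 1) :
    t ^ Fintype.card ι * ∏ i, ‖m i‖ ≤ maxCost p := by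
  classical
  by_cases hz : ∃ i, ‖m i‖ = 0
  · obtain ⟨i, hi⟩ := hz
    rw [Finset.prod_eq_zero (Finset.mem_univ i) hi, mul_zero]
    exact maxCost_nonneg p
  push Not at hz
  -- `t`-norming functionals of the spans of the `i`-th components
  have hψ : ∀ i, ∃ ψ : Module.Dual 𝕜 (V i), ψ (m i) = 1 ∧
      ∀ q ∈ p.toList, t * ‖m i‖ * ‖ψ (q.2 i)‖ ≤ ‖q.2 i‖ := by
    intro i
    obtain ⟨ψ, h1, h2⟩ := Literature.Analysis.OperatorTheory.exists_dual_norming_on_span (𝕜 := 𝕜)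
      ((p.toList.map fun q : 𝕜 × Π i, V i => q.2 i).toFinset) (hz i) ht0 ht1
    refine ⟨ψ, h1, fun q hq => h2 _ (Submodule.subset_span (Set.mem_insert_of_mem _ ?_))⟩
    rw [List.coe_toFinset, Set.mem_setOf_eq, List.mem_map]
    exact ⟨q, hq, rfl⟩
  choose ψ hψ1 hψ2 using hψ
  -- the algebraic product functional `⊗ ψ_i`
  set Ψ : (⨂[𝕜] i, V i) →ₗ[𝕜] 𝕜 := lift ((MultilinearMap.mkPiAlgebra 𝕜 ι 𝕜).compLinearMap ψ) with hΨ
  have hΨt : ∀ x : Π i, V i, Ψ (⨂ₜ[𝕜] i, x i) = ∏ i, ψ i (x i) := fun x => by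
    simp [hΨ, MultilinearMap.mkPiAlgebra_apply]
  -- the identity `1 = Σ_j c_j ∏_i ψ_i (m_{j,i})`
  have hx : (p.toList.map fun q : 𝕜 × Π i, V i => q.1 • ⨂ₜ[𝕜] i, q.2 i).sum = ⨂ₜ[𝕜] i, m i :=
    (mem_lifts_iff _ p).1 hp
  have hone : (p.toList.map fun q : 𝕜 × Π i, V i => q.1 * ∏ i, ψ i (q.2 i)).sum = 1 := by
    have h := congrArg Ψ hx
    rw [hΨt, map_list_sum, List.map_map] at h
    simp only [hψ1, Finset.prod_const_one] at h
    rw [← h]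
    refine congrArg List.sum (List.map_congr_left fun q _ => ?_)
    simp only [Function.comp_apply, map_smul, hΨt, smul_eq_mul]
  -- ultrametric pigeonhole: some term has `‖c_j‖ ∏ ‖ψ_i (m_{j,i})‖ ≥ 1`
  obtain ⟨y, hy, hy1⟩ := exists_norm_ge_of_le_norm_sum zero_lt_one
    (p.toList.map fun q : 𝕜 × Π i, V i => q.1 * ∏ i, ψ i (q.2 i)) (by rw [hone, norm_one])
  obtain ⟨q, hq, rfl⟩ := List.mem_map.1 hy
  rw [norm_mul, norm_prod] at hy1
  -- the bound for that term
  have hprod : ∏ i, (t * ‖m i‖ * ‖ψ i (q.2 i)‖) ≤ ∏ i, ‖q.2 i‖ :=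
    Finset.prod_le_prod (fun i _ => by positivity) fun i _ => hψ2 i q hq
  have hsplit : ∏ i, (t * ‖m i‖ * ‖ψ i (q.2 i)‖) =
      t ^ Fintype.card ι * (∏ i, ‖m i‖) * ∏ i, ‖ψ i (q.2 i)‖ := by
    rw [Finset.prod_mul_distrib, Finset.prod_mul_distrib, Finset.prod_const, Finset.card_univ]
  rw [hsplit] at hprod
  have hnn : 0 ≤ t ^ Fintype.card ι * ∏ i, ‖m i‖ := by positivity
  calc t ^ Fintype.card ι * ∏ i, ‖m i‖
      ≤ (t ^ Fintype.card ι * ∏ i, ‖m i‖) * (‖q.1‖ * ∏ i, ‖ψ i (q.2 i)‖) := le_mul_of_one_le_right hnn hy1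
    _ = ‖q.1‖ * (t ^ Fintype.card ι * (∏ i, ‖m i‖) * ∏ i, ‖ψ i (q.2 i)‖) := by ring
    _ ≤ ‖q.1‖ * ∏ i, ‖q.2 i‖ := mul_le_mul_of_nonneg_left hprod (norm_nonneg _)
    _ ≤ maxCost p := termCost_le_maxCost hq

/-- Every representation of `⨂ₜ m` costs at least `∏ ‖m_i‖` (let `t → 1` in `pow_mul_prod_norm_le_maxCost`). -/
theorem prod_norm_le_maxCost (m : Π i, V i) {p : FreeAddMonoid (𝕜 × Π i, V i)} (hp : p ∈ lifts (⨂ₜ[𝕜] i, m i)) :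
    ∏ i, ‖m i‖ ≤ maxCost p := by
  have htend : Tendsto (fun t : ℝ => t ^ Fintype.card ι * ∏ i, ‖m i‖) (𝓝[<] 1) (𝓝 (∏ i, ‖m i‖)) := by
    have hc : Tendsto (fun t : ℝ => t ^ Fintype.card ι * ∏ i, ‖m i‖) (𝓝 1)
        (𝓝 ((1 : ℝ) ^ Fintype.card ι * ∏ i, ‖m i‖)) :=
      ((continuous_pow (Fintype.card ι)).mul continuous_const).tendsto 1
    rw [one_pow, one_mul] at hc
    exact hc.mono_left nhdsWithin_le_nhds
  refine le_of_tendsto htend ?_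
  filter_upwards [Ioo_mem_nhdsLT zero_lt_one] with t ht using pow_mul_prod_norm_le_maxCost m hp ht.1 ht.2

/-- `∏ ‖m_i‖ ≤ π_max(⨂ₜ m)` — the lower bound of the cross-norm property. -/
theorem prod_norm_le_maxProjNorm (m : Π i, V i) : ∏ i, ‖m i‖ ≤ maxProjNorm (⨂ₜ[𝕜] i, m i) :=
  le_ciInf fun p => prod_norm_le_maxCost m p.2

/-- **[Schneider 2002, Prop. 17.4] — PROVED (finite families): the non-archimedean projective tensor norm is a cross norm.**
For a complete ultrametric nontrivially normed field `𝕜` and ultrametric normed `𝕜`-spaces `V_i`: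
`π_max(⨂ₜ m) = ∏ ‖m_i‖`. This is Joshi's Thm 7.6.2.2 (3) for the norm and the spaces print means. -/
theorem maxProjNorm_tprod (m : Π i, V i) : maxProjNorm (⨂ₜ[𝕜] i, m i) = ∏ i, ‖m i‖ :=
  le_antisymm (maxProjNorm_tprod_le m) (prod_norm_le_maxProjNorm m)

/-- In `HasCrossNorm` form: `π_max` is cross. -/
theorem hasCrossNorm_maxProjNorm : HasCrossNorm (maxProjNorm (𝕜 := 𝕜) (V := V)) :=
  maxProjNorm_tprod

/-- **Consequence: Mathlib's (archimedean-convention) projective norm `π_Σ` is cross as well** in this setting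
(`∏ ≤ π_max ≤ π_Σ ≤ ∏`), in part 1's `HasCrossNorm` form: `hasCrossNorm_norm_of_ultrametric m : ‖⨂ₜ m‖ = ∏ ‖m_i‖`.
(Over `ℝ`, `ℂ` this is part 1's `norm_tprod` / the Literature `norm_tprod_eq_prod_norm_rclike`.) -/
theorem hasCrossNorm_norm_of_ultrametric : HasCrossNorm (fun x : ⨂[𝕜] i, V i => ‖x‖) :=
  fun m => le_antisymm (norm_tprod_le m) ((prod_norm_le_maxProjNorm m).trans (maxProjNorm_le_norm _))

/-- The two projective norms agree on pure tensors. -/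
theorem maxProjNorm_tprod_eq_norm (m : Π i, V i) : maxProjNorm (⨂ₜ[𝕜] i, m i) = ‖(⨂ₜ[𝕜] i, m i)‖ := by
  rw [maxProjNorm_tprod]
  exact (hasCrossNorm_norm_of_ultrametric m).symm

end Cross

/-! ## 2. Joshi's Thm 7.6.2.2 (3)(4) and Lemma 7.6.6.1 (7.6.6.2) for the norm and spaces of print — DISCHARGED -/

section Padic

variable (p : ℕ) [Fact p.Prime] (E : Type u) [NontriviallyNormedField E] [NormedAlgebra ℚ_[p] E]

/-- **Thm 7.6.2.2 (3) for the p-adic-field ENCODING of parts 1/4 — PROVED** [J-III p. 62 l. 11–12; [Schneider 2002, Prop. 17.4]]: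
for `E` a finite-dimensional normed `ℚ_p`-algebra that is a field (hence complete and ultrametric — derived, not assumed) and
every finite family of ULTRAMETRIC normed `E`-spaces (print's Banach spaces; completeness of the `V_i` is not needed),
`π_max(⨂ₜ m) = ∏ ‖m_i‖`. (For `E = ℚ_p` and for spherically complete fields see abc-iut-found's `maxProjNorm_tprod_padic` /
`maxProjNorm_tprod_of_isSphericallyComplete`, obtained via Ingleton; this route uses no spherical completeness.) -/
theorem maxProjNorm_tprod_padicField [FiniteDimensional ℚ_[p] E] {ι : Type v} [Fintype ι] (V : ι → Type w)
    [∀ i, NormedAddCommGroup (V i)] [∀ i, NormedSpace E (V i)] [∀ i, IsUltrametricDist (V i)] (m : Π i, V i) :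
    maxProjNorm (⨂ₜ[E] i, m i) = ∏ i, ‖m i‖ := by
  haveI : CompleteSpace E := FiniteDimensional.complete ℚ_[p] E
  haveI : IsUltrametricDist E := isUltrametricDist_of_normedAlgebra_padic p E
  exact maxProjNorm_tprod m

/-- **The same for Mathlib's norm instance, = Lemma 7.6.6.1 (7.6.6.2) for the encoding — PROVED**: `‖⨂ₜ m‖ = ∏ ‖m_i‖` for
ultrametric normed spaces over a p-adic field `E` (the input (7.7.3.2) of Thm 7.7.3.1, unconditional for ultrametric factors). -/
theorem norm_tprod_padicField [FiniteDimensional ℚ_[p] E] {ι : Type v} [Fintype ι] (V : ι → Type w)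
    [∀ i, NormedAddCommGroup (V i)] [∀ i, NormedSpace E (V i)] [∀ i, IsUltrametricDist (V i)] (m : Π i, V i) :
    ‖(⨂ₜ[E] i, m i)‖ = ∏ i, ‖m i‖ := by
  haveI : CompleteSpace E := FiniteDimensional.complete ℚ_[p] E
  haveI : IsUltrametricDist E := isUltrametricDist_of_normedAlgebra_padic p E
  exact hasCrossNorm_norm_of_ultrametric m

/-- **Thm 7.6.2.2 (2), final faithful typing — HYPOTHESIS** [J-III p. 62 l. 8–10]: over a p-adic field, on every finite family of
ULTRAMETRIC Banach spaces the injective norm and the projective norm of print coincide: `injectiveNorm = maxProjNorm`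
([van der Put–van Tiel 1967, Thm 1]; needs orthogonal bases over spherically complete fields — not in the tree). Supersedes
`ProjEqInjMaxClaim` (no ultrametric binder) and `ProjEqInjClaim` (wrong norm). [claim: Joshi2024ATS3, status: disputed] -/
@[claim "Joshi2024ATS3" "disputed"] def ProjEqInjUltraClaim : Prop :=
  FiniteDimensional ℚ_[p] E →
    ∀ (ι : Type v) [Fintype ι] (V : ι → Type w) [∀ i, NormedAddCommGroup (V i)] [∀ i, NormedSpace E (V i)],
      (∀ i, IsUltrametricDist (V i)) → (∀ i, CompleteSpace (V i)) →
        ∀ x : ⨂[E] i, V i, injectiveNorm x = maxProjNorm x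

variable {p E} in
/-- Under the faithful (2), the injective norm is cross on ultrametric Banach families over a p-adic field — by the PROVED (3).
(The pure-tensor case of (2) is thus equivalent to `injectiveNorm (⨂ₜ m) = ∏ ‖m_i‖`, i.e. to norming functionals / Ingleton.) -/
theorem injectiveNorm_tprod_of_ultraClaim (h : ProjEqInjUltraClaim.{u, v, w} p E) [FiniteDimensional ℚ_[p] E]
    {ι : Type v} [Fintype ι] (V : ι → Type w) [∀ i, NormedAddCommGroup (V i)] [∀ i, NormedSpace E (V i)]
    [∀ i, IsUltrametricDist (V i)] (hc : ∀ i, CompleteSpace (V i)) (m : Π i, V i) :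
    injectiveNorm (⨂ₜ[E] i, m i) = ∏ i, ‖m i‖ := by
  rw [h inferInstance ι V (fun i => inferInstance) hc, maxProjNorm_tprod_padicField p E V m]

end Padic

end Summit.ABC.IUTFork.Joshi.TensorNorm

end
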